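/- Copyright: the b2b-balaban cell (near-miss cell 7), T⁴-continuum fan-out, ROUND-2 swarm `t4-ne7b-formalise-*`
(leaf 01), row NE7b (node U5c COUNT member).  Released under the licence of the surrounding project. -/
import Summits.QuantumFields.BalabanUV.T4Continuum.Support.HistoryRealisePrint

/-!
# Readiness with a GENERAL MEMORY FUNCTION: `StopsM`, the frozen and the current instances, and the monotonicity of
condition (ii) in its memory (row NE7b, INTERFACE REQUEST IR-41-2 of the row's CRUX prover t4-ne7b-p1 gen 41,
`HOME/INBOX.md` block of 2026-08-21T04:38Z; repair route R-41-a after the located MODEL finding F-ne7bleaf01g24-1,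
CONFIRMED by ruling R-OWNER-41-1)

Summits-side support leaf of the T⁴-continuum cell (rung (B)+1 on a FINITE torus only; NOT infinite volume, NOT the
mass gap, NOT the Clay statement; NOT a proof of the spine estimate NE7b, which is the cell's OWN estimate, NOT PRINTED
and NOT PROVED).  [folklore] finite combinatorics over row S1b's `HistoryRealise` (`orbit`, `Stops`, `PendingAt`), the
print-exact core `HistoryRealisePrint` (`PendingBefore`) and the Literature typing `B16StoppingRule` (`CondII`, `StopAt`)
BY NAME; nothing printed is asserted, no `Prop`-valued FACT of Bałaban's is minted (the four `def`s below are
PREDICATES with parameters — hypothesis shapes of OUR model), no cite-tagged hypothesis, zero `sorry`.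
B15 = [Balaban1989LargeFieldI] pp. 177 ∕ 198 and B16 = [Balaban1989LargeFieldII] p. 384 are manuscripts UNDER AUDIT
and appear only as LOCATORS of which parameter is modelled.

WHY.  Row S1b's `Stops L s R t₀ Z k := StopAt 100 (R t₀) ⊤ (orbit L s t₀ Z) k` FREEZES condition (ii)'s memory at the
line's last event `t₀`; print evaluates it at the scale where the 𝐑-operation acts (B15 p. 198 «These two conditions
can be satisfied by N to the positive power of log g_k^{−2}», k the acting level; B16 p. 384 «with N = R_j» for a
component of `Z_j`, re-made per level) — located finding F-ne7bleaf01g24-1, confirmed R-OWNER-41-1 («R-const» and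
«misread» rejected).  THIS FILE carries the readiness predicate with an ARBITRARY memory function `Rm : ℕ → ℕ → ℕ`
(`Rm t₀ k` = the memory demanded at the relative index `k` of a line formed at `t₀`): the landed model is the instance
`Rm t _ := R t` (`stopsM_frozen_iff`, by `Iff.rfl`), print's process the instance `Rm t k := R (t + k)` (`StopsCur`).
Condition (ii) is MONOTONE in its memory (`condII_mono`, `stopAt_mono`), so every memory function dominated by the frozen
one (`∀ t k, Rm t k ≤ R t`) turns a frozen stop into an `Rm`-stop (`stopsM_of_stops`) and `Rm`-pendency into frozen
pendency (`pendingAt_of_pendingM`, `pendingBefore_of_pendingMBefore`): every landed window `K < toGen.reach (dictW R n₁)`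
(`lt_reach_of_pendingAt`, `lt_reach_of_pendingBefore`, `exists_stop_lt_reach(_P)`) applies VERBATIM to the general
reading — the COUNT side is untouched; only the meaning of «ready for the first time» in a renewal clause changes, which
the owner's R-41-a core `HistoryRealiseWeak.RealisesW` no longer asks.  For a NON-INCREASING `R` (print: B15 p. 177 «in
some steps the number R_k decreases by the factor L^{−1}»; a DISPLAYED hypothesis here, T-class) the current memory is
dominated by the frozen one (`stopsCur_of_stops`).  Nothing landed is edited; consumers: IR-41-7's `RunInputM.RdyM`
(leaf-05), the owner's M4.

WHAT.  §1 `condII_mono`, `stopAt_mono`.  §2 `StopsM`, `stopsM_frozen_iff`, `StopsCur`, `stopsCur_iff`, `StopsM.pos`,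
`StopsM.condI`, `StopsM.le`, `StopsM.subset`, `stopsM_mono`, `stopsM_of_stops`, `stopsCur_of_stops`, `exists_stopsM_le`.
§3 `PendingM`, `PendingMBefore`, `pendingM_frozen_iff`, `pendingMBefore_frozen_iff`, `pendingMBefore_of_pendingM`,
`pendingAt_of_pendingM`, `pendingBefore_of_pendingMBefore`, `pendingAt_of_pendingCur`, `pendingBefore_of_pendingCurBefore`.

HONEST.  Proves nothing of Bałaban's; BY-NAME EFFECT ON THE WALL (`WALL-NE7b-P1.md` §2): NONE — a carrier-side
generalisation requested by the owner; NE7b NOT proved; spine 0∕9.  HONEST DEPENDENCY (cell): continuum YM on T⁴ ⇐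
BetaPertH ∧ nine spine estimates (0/9 proved); BetaPertH ⇐ (D1) ∧ (D4) ∧ CAP+tail; G-an2-4 gates asym, D1 and NE2/3/4.
This file changes none of it. -/

open Literature.MathematicalPhysics.QuantumFieldTheory.Balaban1983to89
open Literature.MathematicalPhysics.QuantumFieldTheory.Balaban1983to89.B13ScaleTransfer
open Literature.MathematicalPhysics.QuantumFieldTheory.Balaban1983to89.B16StoppingRule
open Summit.QuantumFields.BalabanUV.T4Continuum.HistoryRealise
open Summit.QuantumFields.BalabanUV.T4Continuum.HistoryRealisePrint

namespace Summit.QuantumFields.BalabanUV.T4Continuum.HistoryRealiseMemory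

variable {d : ℕ}

/-! ## §1 Condition (ii) and the stopping property are monotone in the memory -/

/-- condition (ii) is MONOTONE in its memory: a shorter memory is easier to satisfy. [folklore] -/
theorem condII_mono {Nsz N N' : ℕ} {Clean : ℕ → Prop} {X : ℕ → Finset (Pt d)} {k : ℕ} (hN : N' ≤ N)
    (h : CondII Nsz N Clean X k) : CondII Nsz N' Clean X k :=
  ⟨le_trans hN h.1, fun l hl hlk => h.2 l (by omega) hlk⟩

/-- **the stopping property is monotone in the memory**: `N′ ≤ N → StopAt Nsz N C X k → StopAt Nsz N′ C X k`.
[folklore] -/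
theorem stopAt_mono {Nsz N N' : ℕ} {Clean : ℕ → Prop} {X : ℕ → Finset (Pt d)} {k : ℕ} (hN : N' ≤ N)
    (h : StopAt Nsz N Clean X k) : StopAt Nsz N' Clean X k :=
  ⟨h.1, h.2.1, condII_mono hN h.2.2⟩

/-! ## §2 Readiness with a general memory function -/

/-- **`StopsM L s Rm t₀ Z k`**: the orbit of the domain `Z` formed at `t₀` has the stopping property of p. 384 at the
relative index `k` — conditions (i) (`100` cubes per side) and (ii) with memory `Rm t₀ k`, the steps after `t₀` clean —
for an ARBITRARY memory function `Rm : ℕ → ℕ → ℕ` (formation step, relative index).  The landed `Stops` is the frozen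
instance `Rm t _ := R t`; print's process is the current instance `Rm t k := R (t + k)` (B15 p. 198 ∕ B16 p. 384,
locators only). [folklore] -/
def StopsM (L : ℕ) (s : ℕ → ℕ) (Rm : ℕ → ℕ → ℕ) (t₀ : ℕ) (Z : Finset (Pt d)) (k : ℕ) : Prop :=
  StopAt 100 (Rm t₀ k) (fun _ => True) (orbit L s t₀ Z) k

/-- **the frozen instance IS row S1b's `Stops`** (definitionally). [folklore] -/
theorem stopsM_frozen_iff {L : ℕ} {s R : ℕ → ℕ} {t₀ : ℕ} {Z : Finset (Pt d)} {k : ℕ} :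
    StopsM L s (fun t _ => R t) t₀ Z k ↔ Stops L s R t₀ Z k :=
  Iff.rfl

/-- **`StopsCur L s R`**: readiness with condition (ii)'s memory read at the CURRENT scale `t₀ + k` — the instance
`Rm t k := R (t + k)` (the MODEL's letter for print's «N to the positive power of log g_k^{−2}» ∕ «N = R_j», locators
only). [folklore] -/
def StopsCur (L : ℕ) (s : ℕ → ℕ) (R : ℕ → ℕ) : ℕ → Finset (Pt d) → ℕ → Prop :=
  StopsM L s (fun t k => R (t + k))

/-- `StopsCur` unfolded (definitionally). [folklore] -/
theorem stopsCur_iff {L : ℕ} {s R : ℕ → ℕ} {t₀ : ℕ} {Z : Finset (Pt d)} {k : ℕ} :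
    StopsCur L s R t₀ Z k ↔ StopAt 100 (R (t₀ + k)) (fun _ => True) (orbit L s t₀ Z) k :=
  Iff.rfl

/-- an `Rm`-stop has a positive index [folklore] -/
theorem StopsM.pos {L : ℕ} {s : ℕ → ℕ} {Rm : ℕ → ℕ → ℕ} {t₀ : ℕ} {Z : Finset (Pt d)} {k : ℕ}
    (h : StopsM L s Rm t₀ Z k) : 0 < k :=
  h.1

/-- an `Rm`-stop carries condition (i) at its index [folklore] -/
theorem StopsM.condI {L : ℕ} {s : ℕ → ℕ} {Rm : ℕ → ℕ → ℕ} {t₀ : ℕ} {Z : Finset (Pt d)} {k : ℕ}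
    (h : StopsM L s Rm t₀ Z k) : CondI 100 (orbit L s t₀ Z k) :=
  h.2.1

/-- no `Rm`-stop before the memory demanded at that index has elapsed [folklore] -/
theorem StopsM.le {L : ℕ} {s : ℕ → ℕ} {Rm : ℕ → ℕ → ℕ} {t₀ : ℕ} {Z : Finset (Pt d)} {k : ℕ}
    (h : StopsM L s Rm t₀ Z k) : Rm t₀ k ≤ k :=
  le_of_stopAt h

/-- the `Rm`-stopping property passes to sub-domains (their orbits are smaller) [folklore] -/
theorem StopsM.subset {L : ℕ} {s : ℕ → ℕ} {Rm : ℕ → ℕ → ℕ} {t₀ : ℕ} {Z Z' : Finset (Pt d)} (hZ : Z' ⊆ Z) {k : ℕ}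
    (h : StopsM L s Rm t₀ Z k) : StopsM L s Rm t₀ Z' k := by
  obtain ⟨hk, hI, hN, hall⟩ := h
  exact ⟨hk, condI_subset (orbit_mono L s t₀ hZ k) hI, hN,
    fun l h1 h2 => ⟨trivial, condI_subset (orbit_mono L s t₀ hZ l) (hall l h1 h2).2⟩⟩

/-- **`StopsM` is monotone in the memory function, pointwise at the index**: a memory demand at `(t₀, k)` no larger than
another's turns the other's stop into its own. [folklore] -/
theorem stopsM_mono {L : ℕ} {s : ℕ → ℕ} {Rm Rm' : ℕ → ℕ → ℕ} {t₀ : ℕ} {Z : Finset (Pt d)} {k : ℕ}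
    (hle : Rm' t₀ k ≤ Rm t₀ k) (h : StopsM L s Rm t₀ Z k) : StopsM L s Rm' t₀ Z k :=
  stopAt_mono hle h

/-- **a frozen stop is an `Rm`-stop for every memory function dominated by the frozen memory**:
`(∀ t k, Rm t k ≤ R t) → Stops L s R t₀ Z k → StopsM L s Rm t₀ Z k`. [folklore] -/
theorem stopsM_of_stops {L : ℕ} {s R : ℕ → ℕ} {Rm : ℕ → ℕ → ℕ} (hRm : ∀ t k, Rm t k ≤ R t) {t₀ : ℕ}
    {Z : Finset (Pt d)} {k : ℕ} (h : Stops L s R t₀ Z k) : StopsM L s Rm t₀ Z k :=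
  stopAt_mono (hRm t₀ k) h

/-- **for a NON-INCREASING memory sequence `R`, a frozen-memory stop IS a current-memory stop** (print: B15 p. 177 «in
some steps the number R_k decreases by the factor L^{−1}» — the monotonicity is a DISPLAYED hypothesis). [folklore] -/
theorem stopsCur_of_stops {L : ℕ} {s R : ℕ → ℕ} (hR : ∀ a b, a ≤ b → R b ≤ R a) {t₀ : ℕ} {Z : Finset (Pt d)} {k : ℕ}
    (h : Stops L s R t₀ Z k) : StopsCur L s R t₀ Z k :=
  stopsM_of_stops (Rm := fun t k => R (t + k)) (fun t k => hR t (t + k) (Nat.le_add_right t k)) h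

/-- hence the first `Rm`-stop is no later than any frozen stop (dominated memory). [folklore] -/
theorem exists_stopsM_le {L : ℕ} {s R : ℕ → ℕ} {Rm : ℕ → ℕ → ℕ} (hRm : ∀ t k, Rm t k ≤ R t) {t₀ : ℕ}
    {Z : Finset (Pt d)} {k : ℕ} (h : Stops L s R t₀ Z k) : ∃ k' ≤ k, StopsM L s Rm t₀ Z k' :=
  ⟨k, le_rfl, stopsM_of_stops hRm h⟩

/-! ## §3 Pendency with a general memory function -/

/-- **`PendingM L s Rm t₀ Z K`**: the domain formed at `t₀ ≤ K` is still pending at the cutoff `K` in the `Rm`-reading —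
its orbit has no `Rm`-stop at any index up to `K − t₀` (twin of row S1b's `PendingAt`). [folklore] -/
def PendingM (L : ℕ) (s : ℕ → ℕ) (Rm : ℕ → ℕ → ℕ) (t₀ : ℕ) (Z : Finset (Pt d)) (K : ℕ) : Prop :=
  t₀ ≤ K ∧ ∀ k, k ≤ K - t₀ → ¬ StopsM L s Rm t₀ Z k

/-- **`PendingMBefore L s Rm t₀ Z K`**: no `Rm`-stop at any index STRICTLY BELOW `K − t₀` (twin of the print-exact
`HistoryRealisePrint.PendingBefore`). [folklore] -/
def PendingMBefore (L : ℕ) (s : ℕ → ℕ) (Rm : ℕ → ℕ → ℕ) (t₀ : ℕ) (Z : Finset (Pt d)) (K : ℕ) : Prop :=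
  t₀ ≤ K ∧ ∀ k, k < K - t₀ → ¬ StopsM L s Rm t₀ Z k

/-- the frozen instance of `PendingM` IS `PendingAt` (definitionally). [folklore] -/
theorem pendingM_frozen_iff {L : ℕ} {s R : ℕ → ℕ} {t₀ : ℕ} {Z : Finset (Pt d)} {K : ℕ} :
    PendingM L s (fun t _ => R t) t₀ Z K ↔ PendingAt L s R t₀ Z K :=
  Iff.rfl

/-- the frozen instance of `PendingMBefore` IS `PendingBefore` (definitionally). [folklore] -/
theorem pendingMBefore_frozen_iff {L : ℕ} {s R : ℕ → ℕ} {t₀ : ℕ} {Z : Finset (Pt d)} {K : ℕ} :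
    PendingMBefore L s (fun t _ => R t) t₀ Z K ↔ PendingBefore L s R t₀ Z K :=
  Iff.rfl

/-- `Rm`-pendency through a scale implies `Rm`-pendency strictly before it [folklore] -/
theorem pendingMBefore_of_pendingM {L : ℕ} {s : ℕ → ℕ} {Rm : ℕ → ℕ → ℕ} {t₀ : ℕ} {Z : Finset (Pt d)} {K : ℕ}
    (h : PendingM L s Rm t₀ Z K) : PendingMBefore L s Rm t₀ Z K :=
  ⟨h.1, fun k hk => h.2 k hk.le⟩

/-- **`Rm`-PENDENCY IMPLIES FROZEN PENDENCY** for every memory function dominated by the frozen one: a frozen stop would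
be an `Rm`-stop (`stopsM_of_stops`).  So `lt_reach_of_pendingAt` and every landed `K < toGen.reach (dictW R n₁)` window
apply VERBATIM to the `Rm`-reading. [folklore] -/
theorem pendingAt_of_pendingM {L : ℕ} {s R : ℕ → ℕ} {Rm : ℕ → ℕ → ℕ} (hRm : ∀ t k, Rm t k ≤ R t) {t₀ : ℕ}
    {Z : Finset (Pt d)} {K : ℕ} (h : PendingM L s Rm t₀ Z K) : PendingAt L s R t₀ Z K :=
  ⟨h.1, fun k hk hs => h.2 k hk (stopsM_of_stops hRm hs)⟩

/-- the same one index short of the cutoff: `PendingMBefore → PendingBefore` (dominated memory), so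
`lt_reach_of_pendingBefore` applies verbatim. [folklore] -/
theorem pendingBefore_of_pendingMBefore {L : ℕ} {s R : ℕ → ℕ} {Rm : ℕ → ℕ → ℕ} (hRm : ∀ t k, Rm t k ≤ R t) {t₀ : ℕ}
    {Z : Finset (Pt d)} {K : ℕ} (h : PendingMBefore L s Rm t₀ Z K) : PendingBefore L s R t₀ Z K :=
  ⟨h.1, fun k hk hs => h.2 k hk (stopsM_of_stops hRm hs)⟩

/-- the current-memory instance: for a NON-INCREASING `R`, current pendency through `K` implies `PendingAt … K`.
[folklore] -/
theorem pendingAt_of_pendingCur {L : ℕ} {s R : ℕ → ℕ} (hR : ∀ a b, a ≤ b → R b ≤ R a) {t₀ : ℕ} {Z : Finset (Pt d)}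
    {K : ℕ} (h : PendingM L s (fun t k => R (t + k)) t₀ Z K) : PendingAt L s R t₀ Z K :=
  pendingAt_of_pendingM (fun t k => hR t (t + k) (Nat.le_add_right t k)) h

/-- … and current pendency strictly before `K` implies `PendingBefore … K`. [folklore] -/
theorem pendingBefore_of_pendingCurBefore {L : ℕ} {s R : ℕ → ℕ} (hR : ∀ a b, a ≤ b → R b ≤ R a) {t₀ : ℕ}
    {Z : Finset (Pt d)} {K : ℕ} (h : PendingMBefore L s (fun t k => R (t + k)) t₀ Z K) :
    PendingBefore L s R t₀ Z K :=
  pendingBefore_of_pendingMBefore (fun t k => hR t (t + k) (Nat.le_add_right t k)) h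

end Summit.QuantumFields.BalabanUV.T4Continuum.HistoryRealiseMemory
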